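import Summits.Parity.BatemanHorn.Theses.LambertRoots
import Summits.Parity.BatemanHorn.Theorems.IsogenyRedeiLambdaToCount

/-!
# Birth skeleton (BC3) for crux `LambertRoots.FrameToBH` (stmt-Parity-16330)

Crux (FIXED; concluded BY NAME by `FrameToBH_of` below): for every Bateman–Horn system
`f = (f₁,…,f_k)`, the three per-system crux conclusions of route LambertRoots —
`DeepTail_f` (lcm > x^{1+η} tail is o(x), every η), `NearWindow_f` (some A, η: the range
x(log x)^A < lcm ≤ x^{1+η} is o(x)) and `MuRootWeyl_f` (∏μ·log-twisted joint-root Weyl sums save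
every log-power at polylog frequencies) — imply `BatemanHornAsymptotic f`.

## The line: Lambert frame = singular series ⊕ low-lcm range ⊕ Tauberian step (+ Λ→count, PROVED)

Write `w(d) = ∏ᵢ μ(dᵢ) log dᵢ`, `E_f(x) = Σ_{1≤n≤x²} e^{−n/x} ∏ᵢ Λ(fᵢ(n))` (the smoothed Λ-count) and,
for a cut `Y(x)`, `Σ_f^{≤Y}(x) = Σ_{1≤n≤x²} e^{−n/x} Σ_{dᵢ ∣ fᵢ(n), lcm d ≤ Y} w(d)` (and similarly for
lcm-ranges).  KERNEL-CHECKED here (composition `frameToBH_of_parts`, no sorry):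

* `∏ᵢ Λ(mᵢ) = (−1)^k Σ_{d ∈ ∏ᵢ divisors(mᵢ)} w(d)` for every `m : Fin k → ℕ` (Mathlib
  `ArithmeticFunction.sum_moebius_mul_log_eq` + `Finset.prod_univ_sum`) — the sign `(−1)^k`;
* the three-way lcm split `E_f(x) = (−1)^k (Σ^{≤x(log x)^A} + Σ^{(x(log x)^A, x^{1+η}]} + Σ^{>x^{1+η}})`,
  valid as soon as `x(log x)^A ≤ x^{1+η}` (eventually: `isLittleO_log_rpow_rpow_atTop`) — with `A, η`
  THOSE PRODUCED BY `NearWindow_f` and `DeepTail_f` specialised to that `η`;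
* the o-algebra `E_f(x) − C x = (−1)^k[(Σ^{≤·} − (−1)^k C x) + Near + Deep] = o(x)` (using
  `(−1)^k (−1)^k = 1`), `E_f(x)/x → C`, then `stub_tauberStep` and the TREE theorem
  `Summit.Parity.BatemanHorn.LambdaToCount.lambdaToCount_proof` (stmt-Parity-0874, = route support
  `LambdaToCount` verbatim) to reach `BatemanHornAsymptotic f`.

The three registered stubs (each a genuine theorem-grade lemma, stated over tree/Mathlib vocabulary only,
so each lands verbatim as `Summits/Parity/BatemanHorn/Theorems/LambertRootsFrameToBH<Stub>.lean`
with `--supports stmt-Parity-16330`):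

* `stub_singularSeriesLcm` — VERBATIM the route support `SingularSeriesLcm` (stmt-Parity-16280): for every
  BH system there is `C > 0` with `HasBatemanHornConst f C` and the lcm-ORDERED log-weighted singular
  series `S_f(y) = Σ_{lcm d ≤ y} w(d) ρ_f(d)/lcm d → (−1)^k C` (`ρ_f(d)` = number of joint root classes
  mod lcm).  Golomb–Conrad singular series (Conrad 2003 Thm 7, product form; Pontes 2012 Ch. 6), prime
  ideal theorem with error in the splitting fields; the ONLY place where the sign `(−1)^k` and the value
  `C(f)` enter.  Size L.  (Existence of `C > 0` with `HasBatemanHornConst` alone is the tree theorem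
  `IsBatemanHornSystem.hasBatemanHornConst_holds`; the content is the convergence and the value.)
* `stub_lowLcmRange` — the LOW-lcm RANGE of the Lambert frame (the dropped support `LambertFrame`,
  stmt-Parity-16281, minus what the other two cruxes and the other two stubs own), SIGN-AGNOSTIC: for every
  BH system `f`, every real `S₀` with `S_f(y) → S₀`, and `MuRootWeyl_f`, for EVERY `A > 0`:
  `Σ_f^{≤ x(log x)^A}(x) = S₀·x + o(x)`.  Proof plan (Hindry–Rivoal (14); all theorem-grade): exchange the
  finite sums; each joint root class `ν mod L` (L = lcm d ≤ x(log x)^A < x²) contributes the geometric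
  series `Σ_m e^{−(ν+mL)/x} = (x/L)·h_{L/x}(ν/L) + O(1)`, `h_T(a) = T e^{−aT}/(1 − e^{−T})`, `∫₀¹ h_T = 1`;
  (i) `lcm ≤ x/(log x)^{A'}` (A' = A'(k, f) large): `h_T = 1 + O(T)`, so this range is
  `x·S_f(x/(log x)^{A'}) + O(x(log x)^{k+c−A'})` by `Σ_{lcm ≤ y}|w|ρ_f ≪ y(log y)^{c}(log x)^k`
  (`ρ_f(d) ≤ ∏ (deg fᵢ)^{ω(dᵢ)}`); (ii) the WINDOW `x/(log x)^{A'} < lcm ≤ x(log x)^A`: mean part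
  `x(S_f(x(log x)^A) − S_f(x/(log x)^{A'})) = o(x)`; oscillatory part: Fourier-truncate `h_T − 1`
  (coefficients `T/(T + 2πij)`) at `|j| ≤ (log x)^B`, roots with `ν/L` within `(log x)^{−B'}` of `0, 1`
  counted by divisor sums `Σ_{r ≤ y} ∏ τ(|fᵢ(±r)|) ≪ y(log y)^c` (the finitely many classes with
  `fᵢ(±r) = 0`, i.e. a linear member with an integer root, by the PNT for μ with log-power saving), then
  `MuRootWeyl_f` by partial summation in `L`; truncation `n ≤ x²` costs `e^{−x}x²(log x)^c`.  Consumes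
  exactly the singular-series LIMIT and `MuRootWeyl_f`; does not see `DeepTail`/`NearWindow`.  HARDEST
  stub (size L; pure analysis, no arithmetic conjecture inside).
* `stub_tauberStep` — VERBATIM the route support `TauberStep` (stmt-Parity-16282): positivity un-smooths,
  `E_f(x)/x → C` (x : ℕ → ∞) ⟹ `Σ_{n≤x} ∏Λ(fᵢ(n)) ~ C x`: monotone interpolation in the smoothing
  parameter, truncation `n > x²` negligible, then the tree theorem
  `Literature.NumberTheory.LFunctions.HardyLittlewoodTauberianSums_holds` (Montgomery–Vaughan Thm 5.7).
  Size M, provable now.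

## Why this cut

`FrameToBH` is theorem-grade glue whose named failure modes (route docstring) are bookkeeping: the sign
`(−1)^k`, lcm vs `∏dᵢ`, the truncation `n ≤ x²`, endpoint classes, kernel normalisation.  The cut puts the
SIGN and the RANGE BOOKKEEPING (which `A`, which `η`, strict/non-strict inequalities matching `DeepTail`
/ `NearWindow` exactly) into the kernel-checked composition, isolates the value `(−1)^k C(f)` in ONE stub
(`stub_singularSeriesLcm`, lcm-normalised as the frame produces it), and leaves the analytic heart — the
exact geometric series + mean-one kernel + `MuRootWeyl` window — as ONE sign-agnostic stub that can be
proved for an arbitrary limit `S₀`.  Two of the three stubs are the route's own support items verbatim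
(one proof closes both); `LambdaToCount` is consumed as the landed theorem, not re-stubbed.

No stub is the crux or the summit in costume: `stub_singularSeriesLcm` and `stub_tauberStep` do not
mention `DeepTail`/`NearWindow`/`MuRootWeyl` at all; `stub_lowLcmRange` concludes an asymptotic for a
truncated divisor sum, not `BatemanHornAsymptotic`; the BC3 probes `stub → FrameToBH` and
`stub → BatemanHorn` by `first | exact? | simpa | aesop` FAIL for all three (folder `bc/probe_*.lean`,
verdicts quoted in `Lines/birth.md`).

Foreseen layer 2 (NOT filed; for the line lead): `stub_lowLcmRange ⇐ smallLcmRange (∃ A₀ ∀ A' ≥ A₀: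
Σ^{≤ x/(log x)^{A'}} = S₀ x + o(x), from the S-limit alone) + lcmWindow (∀ A A' > 0: Σ^{(x/(log x)^{A'},
x(log x)^A]} = o(x), from the S-limit and MuRootWeyl_f)` — the same pointwise range split as here.

## Disproof / negatives / barriers

`ledger crux ls stmt-Parity-16330`: no workfiles (no `Disproof.lean`, no `_false_without_` theorem to
honour, no landed `Theorems/FrameToBH/Negative/*`); `ledger negatives --problem Parity`: nothing of this
shape.  Barriers: none of the catalogued Parity barriers (`SelbergParityBarrier`, `FordMaynard*`,
`LogarithmicAveraging`, `CircleMethodBinaryBarrier`, `UniformBatemanHornBarrier`) bites a stub: all parity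
content of the route sits in `DeepTail`/`NearWindow` (hypotheses of the crux, untouched here);
`LogarithmicAveraging` is evaded as in the route header (Abel mean of a NON-NEGATIVE sequence → Cesàro by
Hardy–Littlewood–Karamata, inside `stub_tauberStep`); every stub is per-system (never uniform in `f`).
-/

namespace Summit.Parity.BatemanHorn.Cruxes.FrameToBH.Birth

open scoped BigOperators Topology Classical
open Filter Asymptotics
open Literature.NumberTheory.Sieve
open Summit.Parity.BatemanHorn.Theses.LambertRoots (FrameToBH)

set_option linter.unusedVariables false

/-! ## The stubs -/

/-- **Stub 1 — `stub_singularSeriesLcm` (VERBATIM the route support `SingularSeriesLcm`, stmt-Parity-16280;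
theorem-grade, size L).**  For every Bateman–Horn system `f` there is `C > 0` with `HasBatemanHornConst f C`
and `Σ_(tuples d ∈ [1,y]^k, lcm d ≤ y) (∏ᵢ μ(dᵢ) log dᵢ) · ρ_f(d)/lcm d → (−1)^k C` as `y → ∞`, where
`ρ_f(d) = #{ν < lcm d : dᵢ ∣ fᵢ(ν) ∀ i}`.  Golomb–Conrad log-weighted singular series in lcm order
(Conrad 2003 Thm 7 product form; Bateman–Horn 1962 §2; Pontes 2012 Ch. 6): prime ideal theorem with
error in the splitting fields.  The only stub that knows the sign `(−1)^k` and the value `C(f)`.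
[Conrad2003HardyLittlewoodConstants, BatemanHornMathComp1962, Pontes2012GolombBatemanHorn] -/
theorem stub_singularSeriesLcm :
    ∀ (k : ℕ) (f : Fin k → Polynomial ℤ), Literature.NumberTheory.Sieve.IsBatemanHornSystem f →
      ∃ C : ℝ, 0 < C ∧ Literature.NumberTheory.Sieve.HasBatemanHornConst f C ∧
        Filter.Tendsto (fun y : ℕ => ∑ d ∈ (Fintype.piFinset fun _ : Fin k => Finset.Icc 1 y).filter (fun d => Finset.univ.lcm d ≤ y), (∏ i, ((ArithmeticFunction.moebius (d i) : ℝ) * Real.log (d i))) * ((((Finset.range (Finset.univ.lcm d)).filter (fun ν : ℕ => ∀ i, ((d i : ℕ) : ℤ) ∣ (f i).eval (ν : ℤ))).card : ℝ) / ((Finset.univ.lcm d : ℕ) : ℝ))) Filter.atTop (nhds ((-1 : ℝ) ^ k * C)) := by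
  sorry

/-- **Stub 2 — `stub_lowLcmRange` (the low-lcm range of the Lambert frame; theorem-grade, size L,
HARDEST).**  For every Bateman–Horn system `f`, every `S₀` with
`Σ_(lcm d ≤ y) (∏ᵢ μ(dᵢ) log dᵢ) ρ_f(d)/lcm d → S₀`, and `MuRootWeyl_f` (log-power saving in
∏μ·log-twisted joint-root Weyl sums at polylog frequencies, every exponent), for EVERY `A > 0`:
`Σ_(1≤n≤x²) e^(−n/x) Σ_(dᵢ ∣ fᵢ(n), lcm d ≤ x(log x)^A) ∏ᵢ μ(dᵢ) log dᵢ = S₀ x + o(x)`.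
Exchange of finite sums + exact geometric series over joint root classes (Hindry–Rivoal (14)),
`h_T(a) = T e^{−aT}/(1 − e^{−T})` with `∫₀¹ h_T = 1`; lcm ≤ x/(log x)^{A'} trivially from the limit
`S₀` and `Σ_{lcm ≤ y} |w| ρ_f ≪ y (log y)^c`; the window `x/(log x)^{A'} < lcm ≤ x(log x)^A` by Fourier
truncation of `h_T − 1` at `|j| ≤ (log x)^B`, near-endpoint roots by divisor sums (integer-root classes
of linear members by PNT for μ), and `MuRootWeyl_f` by partial summation in `L`.  Sign-agnostic (any
`S₀`); does not mention `DeepTail` / `NearWindow`.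
[HindryRivoal2005Golomb, Golomb1970, MontgomeryVaughan2007, Hooley1964, DukeFriedlanderIwaniec1995] -/
theorem stub_lowLcmRange :
    ∀ (k : ℕ) (f : Fin k → Polynomial ℤ), Literature.NumberTheory.Sieve.IsBatemanHornSystem f →
      ∀ S₀ : ℝ, Filter.Tendsto (fun y : ℕ => ∑ d ∈ (Fintype.piFinset fun _ : Fin k => Finset.Icc 1 y).filter (fun d => Finset.univ.lcm d ≤ y), (∏ i, ((ArithmeticFunction.moebius (d i) : ℝ) * Real.log (d i))) * ((((Finset.range (Finset.univ.lcm d)).filter (fun ν : ℕ => ∀ i, ((d i : ℕ) : ℤ) ∣ (f i).eval (ν : ℤ))).card : ℝ) / ((Finset.univ.lcm d : ℕ) : ℝ))) Filter.atTop (nhds S₀) →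
        (∀ A B : ℝ, 0 < A → 0 < B → ∃ C₁ : ℝ, ∃ D₀ : ℕ, ∀ D : ℕ, D₀ ≤ D → ∀ j : ℤ, j ≠ 0 → (|j| : ℝ) ≤ Real.log D ^ B → ‖∑ d ∈ (Fintype.piFinset fun _ : Fin k => Finset.Icc 1 D).filter (fun d => Finset.univ.lcm d ≤ D), ((∏ i, ((ArithmeticFunction.moebius (d i) : ℝ) * Real.log (d i)) : ℝ) : ℂ) * ∑ ν ∈ (Finset.range (Finset.univ.lcm d)).filter (fun ν : ℕ => ∀ i, ((d i : ℕ) : ℤ) ∣ (f i).eval (ν : ℤ)), Complex.exp (2 * Real.pi * Complex.I * ((j : ℂ) * (ν : ℂ) / ((Finset.univ.lcm d : ℕ) : ℂ)))‖ ≤ C₁ * (D : ℝ) / Real.log D ^ A) →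
        ∀ A : ℝ, 0 < A →
          (fun x : ℕ => (∑ n ∈ Finset.Icc 1 (x ^ 2), Real.exp (-((n : ℝ) / x)) * ∑ d ∈ Fintype.piFinset (fun i => (((f i).eval (n : ℤ)).toNat).divisors), if ((Finset.univ.lcm d : ℕ) : ℝ) ≤ (x : ℝ) * Real.log x ^ A then ∏ i, ((ArithmeticFunction.moebius (d i) : ℝ) * Real.log (d i)) else 0) - S₀ * (x : ℝ)) =o[Filter.atTop] fun x : ℕ => (x : ℝ) := by
  sorry

/-- **Stub 3 — `stub_tauberStep` (VERBATIM the route support `TauberStep`, stmt-Parity-16282; size M,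
provable now).**  Positivity un-smooths: for a Bateman–Horn system `f` and `C > 0`,
`Σ_{n ≤ x²} e^{−n/x} ∏ᵢ Λ(fᵢ(n)) / x → C` (x : ℕ → ∞) implies `Σ_{n ≤ x} ∏ᵢ Λ(fᵢ(n)) ~ C x`:
monotone interpolation in the smoothing parameter, truncation `n > x²` negligible
(`∏Λ(fᵢ(n)) ≤ ∏ log fᵢ(n)`), then the tree theorem
`Literature.NumberTheory.LFunctions.HardyLittlewoodTauberianSums_holds` (Montgomery–Vaughan 2007
Thm 5.7, `λ_n = n`, `β = 1`). [MontgomeryVaughan2007, HindryRivoal2005Golomb] -/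
theorem stub_tauberStep :
    ∀ (k : ℕ) (f : Fin k → Polynomial ℤ), Literature.NumberTheory.Sieve.IsBatemanHornSystem f →
      ∀ C : ℝ, 0 < C → Filter.Tendsto (fun x : ℕ => (∑ n ∈ Finset.Icc 1 (x ^ 2), Real.exp (-((n : ℝ) / x)) * ∏ i, ArithmeticFunction.vonMangoldt (((f i).eval (n : ℤ)).toNat)) / (x : ℝ)) Filter.atTop (nhds C) →
        Asymptotics.IsEquivalent Filter.atTop (fun x : ℕ => ∑ n ∈ Finset.Icc 1 x, ∏ i, ArithmeticFunction.vonMangoldt (((f i).eval (n : ℤ)).toNat)) (fun x : ℕ => C * (x : ℝ)) := by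
  sorry

/-! ## Kernel-checked bookkeeping -/

/-- `Λ(m) = −Σ_{e ∣ m} μ(e) log e` (Mathlib `ArithmeticFunction.sum_moebius_mul_log_eq`, `Real.log` spelling). -/
theorem vonMangoldt_eq_neg_sum (m : ℕ) :
    ArithmeticFunction.vonMangoldt m =
      (-1 : ℝ) * ∑ e ∈ m.divisors, ((ArithmeticFunction.moebius e : ℝ) * Real.log e) := by
  have h : (∑ e ∈ m.divisors, ((ArithmeticFunction.moebius e : ℝ) * Real.log e)) =
      -ArithmeticFunction.vonMangoldt m := by
    simpa only [ArithmeticFunction.log_apply] using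
      (ArithmeticFunction.sum_moebius_mul_log_eq (n := m))
  linarith

/-- **The sign.** `∏ᵢ Λ(mᵢ) = (−1)^k Σ_{d ∈ ∏ᵢ divisors(mᵢ)} ∏ᵢ μ(dᵢ) log dᵢ` for every `m : Fin k → ℕ`
(`Finset.prod_univ_sum`); for `mᵢ = 0` both sides vanish (`divisors 0 = ∅`, `Λ 0 = 0`). -/
theorem prod_vonMangoldt_eq_sum {k : ℕ} (m : Fin k → ℕ) :
    ∏ i, ArithmeticFunction.vonMangoldt (m i) =
      (-1 : ℝ) ^ k * ∑ d ∈ Fintype.piFinset (fun i => (m i).divisors),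
        ∏ i, ((ArithmeticFunction.moebius (d i) : ℝ) * Real.log (d i)) := by
  calc ∏ i, ArithmeticFunction.vonMangoldt (m i)
      = ∏ i, ((-1 : ℝ) * ∑ e ∈ (m i).divisors, ((ArithmeticFunction.moebius e : ℝ) * Real.log e)) :=
        Finset.prod_congr rfl fun i _ => vonMangoldt_eq_neg_sum (m i)
    _ = (-1 : ℝ) ^ k * ∏ i, ∑ e ∈ (m i).divisors, ((ArithmeticFunction.moebius e : ℝ) * Real.log e) := by
        rw [Finset.prod_mul_distrib, Finset.prod_const, Finset.card_univ, Fintype.card_fin]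
    _ = (-1 : ℝ) ^ k * ∑ d ∈ Fintype.piFinset (fun i => (m i).divisors),
          ∏ i, ((ArithmeticFunction.moebius (d i) : ℝ) * Real.log (d i)) := by
        rw [Finset.prod_univ_sum]

/-- **The three lcm ranges** (pointwise): for `y₁ ≤ y₂` every weight splits as
`[L ≤ y₁] + [y₁ < L ≤ y₂] + [y₂ < L]`. -/
theorem sum_split_three {ι : Type*} (s : Finset ι) (w : ι → ℝ) (L : ι → ℝ) (y₁ y₂ : ℝ)
    (h : y₁ ≤ y₂) :
    ∑ d ∈ s, w d = (∑ d ∈ s, if L d ≤ y₁ then w d else 0) +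
      (∑ d ∈ s, if y₁ < L d ∧ L d ≤ y₂ then w d else 0) +
      (∑ d ∈ s, if y₂ < L d then w d else 0) := by
  rw [← Finset.sum_add_distrib, ← Finset.sum_add_distrib]
  refine Finset.sum_congr rfl fun d _ => ?_
  by_cases h₁ : L d ≤ y₁
  · have h₂ : ¬(y₁ < L d ∧ L d ≤ y₂) := fun hh => absurd h₁ (not_le.mpr hh.1)
    have h₃ : ¬(y₂ < L d) := not_lt.mpr (h₁.trans h)
    rw [if_pos h₁, if_neg h₂, if_neg h₃]; ring
  · by_cases h₃ : y₂ < L d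
    · have h₂ : ¬(y₁ < L d ∧ L d ≤ y₂) := fun hh => absurd hh.2 (not_le.mpr h₃)
      rw [if_neg h₁, if_neg h₂, if_pos h₃]; ring
    · have h₂ : y₁ < L d ∧ L d ≤ y₂ := ⟨not_le.mp h₁, not_lt.mp h₃⟩
      rw [if_neg h₁, if_pos h₂, if_neg h₃]; ring

/-- **Total = (−1)^k (low + near + deep)** at every `x` with `x (log x)^A ≤ x^(1+η)`: the smoothed
Λ-count `Σ_{n≤x²} e^{−n/x} ∏ᵢ Λ(fᵢ(n))` equals `(−1)^k` times the sum of the three lcm-range pieces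
appearing in `stub_lowLcmRange`, `NearWindow_f`, `DeepTail_f` (same strict/non-strict cuts). -/
theorem total_split {k : ℕ} (f : Fin k → Polynomial ℤ) (A η : ℝ) (x : ℕ)
    (hxy : (x : ℝ) * Real.log x ^ A ≤ (x : ℝ) ^ (1 + η)) :
    (∑ n ∈ Finset.Icc 1 (x ^ 2), Real.exp (-((n : ℝ) / x)) * ∏ i, ArithmeticFunction.vonMangoldt (((f i).eval (n : ℤ)).toNat)) =
      (-1 : ℝ) ^ k * ((∑ n ∈ Finset.Icc 1 (x ^ 2), Real.exp (-((n : ℝ) / x)) * ∑ d ∈ Fintype.piFinset (fun i => (((f i).eval (n : ℤ)).toNat).divisors), if ((Finset.univ.lcm d : ℕ) : ℝ) ≤ (x : ℝ) * Real.log x ^ A then ∏ i, ((ArithmeticFunction.moebius (d i) : ℝ) * Real.log (d i)) else 0) +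
        (∑ n ∈ Finset.Icc 1 (x ^ 2), Real.exp (-((n : ℝ) / x)) * ∑ d ∈ Fintype.piFinset (fun i => (((f i).eval (n : ℤ)).toNat).divisors), if (x : ℝ) * Real.log x ^ A < ((Finset.univ.lcm d : ℕ) : ℝ) ∧ ((Finset.univ.lcm d : ℕ) : ℝ) ≤ (x : ℝ) ^ (1 + η) then ∏ i, ((ArithmeticFunction.moebius (d i) : ℝ) * Real.log (d i)) else 0) +
        (∑ n ∈ Finset.Icc 1 (x ^ 2), Real.exp (-((n : ℝ) / x)) * ∑ d ∈ Fintype.piFinset (fun i => (((f i).eval (n : ℤ)).toNat).divisors), if (x : ℝ) ^ (1 + η) < ((Finset.univ.lcm d : ℕ) : ℝ) then ∏ i, ((ArithmeticFunction.moebius (d i) : ℝ) * Real.log (d i)) else 0)) := by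
  rw [← Finset.sum_add_distrib, ← Finset.sum_add_distrib, Finset.mul_sum]
  refine Finset.sum_congr rfl fun n _ => ?_
  rw [prod_vonMangoldt_eq_sum,
    sum_split_three (Fintype.piFinset (fun i => (((f i).eval (n : ℤ)).toNat).divisors))
      (fun d => ∏ i, ((ArithmeticFunction.moebius (d i) : ℝ) * Real.log (d i))) (fun d => ((Finset.univ.lcm d : ℕ) : ℝ))
      ((x : ℝ) * Real.log x ^ A) ((x : ℝ) ^ (1 + η)) hxy]
  ring

/-! ## Composition (REAL proof): the three stub STATEMENTS imply the crux BODY -/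

/-- **Composition in hypothesis form.**  The statements of `stub_singularSeriesLcm`, `stub_lowLcmRange`,
`stub_tauberStep` imply the body of `LambertRoots.FrameToBH`: take `C` and the singular-series limit
`(−1)^k C` from stub 1; `A, η` from `NearWindow_f`; specialise `DeepTail_f` at `η` and stub 2 at
`S₀ = (−1)^k C` and `A`; split the smoothed Λ-count (`total_split`, eventually in `x`); the three pieces
are `o(x)` after subtracting `(−1)^k C x` from the low one, and `(−1)^k (−1)^k = 1`, so
`E_f(x) − C x = o(x)`, i.e. `E_f(x)/x → C`; stub 3 un-smooths; the tree theorem `lambdaToCount_proof`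
(stmt-Parity-0874) converts `Σ_{n≤x} ∏Λ(fᵢ(n)) ~ C x` into `BatemanHornAsymptotic f`. -/
theorem frameToBH_of_parts
    (h₁ : ∀ (k : ℕ) (f : Fin k → Polynomial ℤ), Literature.NumberTheory.Sieve.IsBatemanHornSystem f →
      ∃ C : ℝ, 0 < C ∧ Literature.NumberTheory.Sieve.HasBatemanHornConst f C ∧
        Filter.Tendsto (fun y : ℕ => ∑ d ∈ (Fintype.piFinset fun _ : Fin k => Finset.Icc 1 y).filter (fun d => Finset.univ.lcm d ≤ y), (∏ i, ((ArithmeticFunction.moebius (d i) : ℝ) * Real.log (d i))) * ((((Finset.range (Finset.univ.lcm d)).filter (fun ν : ℕ => ∀ i, ((d i : ℕ) : ℤ) ∣ (f i).eval (ν : ℤ))).card : ℝ) / ((Finset.univ.lcm d : ℕ) : ℝ))) Filter.atTop (nhds ((-1 : ℝ) ^ k * C)))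
    (h₂ : ∀ (k : ℕ) (f : Fin k → Polynomial ℤ), Literature.NumberTheory.Sieve.IsBatemanHornSystem f →
      ∀ S₀ : ℝ, Filter.Tendsto (fun y : ℕ => ∑ d ∈ (Fintype.piFinset fun _ : Fin k => Finset.Icc 1 y).filter (fun d => Finset.univ.lcm d ≤ y), (∏ i, ((ArithmeticFunction.moebius (d i) : ℝ) * Real.log (d i))) * ((((Finset.range (Finset.univ.lcm d)).filter (fun ν : ℕ => ∀ i, ((d i : ℕ) : ℤ) ∣ (f i).eval (ν : ℤ))).card : ℝ) / ((Finset.univ.lcm d : ℕ) : ℝ))) Filter.atTop (nhds S₀) →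
        (∀ A B : ℝ, 0 < A → 0 < B → ∃ C₁ : ℝ, ∃ D₀ : ℕ, ∀ D : ℕ, D₀ ≤ D → ∀ j : ℤ, j ≠ 0 → (|j| : ℝ) ≤ Real.log D ^ B → ‖∑ d ∈ (Fintype.piFinset fun _ : Fin k => Finset.Icc 1 D).filter (fun d => Finset.univ.lcm d ≤ D), ((∏ i, ((ArithmeticFunction.moebius (d i) : ℝ) * Real.log (d i)) : ℝ) : ℂ) * ∑ ν ∈ (Finset.range (Finset.univ.lcm d)).filter (fun ν : ℕ => ∀ i, ((d i : ℕ) : ℤ) ∣ (f i).eval (ν : ℤ)), Complex.exp (2 * Real.pi * Complex.I * ((j : ℂ) * (ν : ℂ) / ((Finset.univ.lcm d : ℕ) : ℂ)))‖ ≤ C₁ * (D : ℝ) / Real.log D ^ A) →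
        ∀ A : ℝ, 0 < A →
          (fun x : ℕ => (∑ n ∈ Finset.Icc 1 (x ^ 2), Real.exp (-((n : ℝ) / x)) * ∑ d ∈ Fintype.piFinset (fun i => (((f i).eval (n : ℤ)).toNat).divisors), if ((Finset.univ.lcm d : ℕ) : ℝ) ≤ (x : ℝ) * Real.log x ^ A then ∏ i, ((ArithmeticFunction.moebius (d i) : ℝ) * Real.log (d i)) else 0) - S₀ * (x : ℝ)) =o[Filter.atTop] fun x : ℕ => (x : ℝ))
    (h₃ : ∀ (k : ℕ) (f : Fin k → Polynomial ℤ), Literature.NumberTheory.Sieve.IsBatemanHornSystem f →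
      ∀ C : ℝ, 0 < C → Filter.Tendsto (fun x : ℕ => (∑ n ∈ Finset.Icc 1 (x ^ 2), Real.exp (-((n : ℝ) / x)) * ∏ i, ArithmeticFunction.vonMangoldt (((f i).eval (n : ℤ)).toNat)) / (x : ℝ)) Filter.atTop (nhds C) →
        Asymptotics.IsEquivalent Filter.atTop (fun x : ℕ => ∑ n ∈ Finset.Icc 1 x, ∏ i, ArithmeticFunction.vonMangoldt (((f i).eval (n : ℤ)).toNat)) (fun x : ℕ => C * (x : ℝ))) :
    ∀ (k : ℕ) (f : Fin k → Polynomial ℤ), Literature.NumberTheory.Sieve.IsBatemanHornSystem f →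
      (∀ η : ℝ, 0 < η → (fun x : ℕ => ∑ n ∈ Finset.Icc 1 (x ^ 2), Real.exp (-((n : ℝ) / x)) * ∑ d ∈ Fintype.piFinset (fun i => (((f i).eval (n : ℤ)).toNat).divisors), if (x : ℝ) ^ (1 + η) < ((Finset.univ.lcm d : ℕ) : ℝ) then ∏ i, ((ArithmeticFunction.moebius (d i) : ℝ) * Real.log (d i)) else 0) =o[Filter.atTop] fun x : ℕ => (x : ℝ)) →
      (∃ A η : ℝ, 0 < A ∧ 0 < η ∧ (fun x : ℕ => ∑ n ∈ Finset.Icc 1 (x ^ 2), Real.exp (-((n : ℝ) / x)) * ∑ d ∈ Fintype.piFinset (fun i => (((f i).eval (n : ℤ)).toNat).divisors), if (x : ℝ) * Real.log x ^ A < ((Finset.univ.lcm d : ℕ) : ℝ) ∧ ((Finset.univ.lcm d : ℕ) : ℝ) ≤ (x : ℝ) ^ (1 + η) then ∏ i, ((ArithmeticFunction.moebius (d i) : ℝ) * Real.log (d i)) else 0) =o[Filter.atTop] fun x : ℕ => (x : ℝ)) →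
      (∀ A B : ℝ, 0 < A → 0 < B → ∃ C₁ : ℝ, ∃ D₀ : ℕ, ∀ D : ℕ, D₀ ≤ D → ∀ j : ℤ, j ≠ 0 → (|j| : ℝ) ≤ Real.log D ^ B → ‖∑ d ∈ (Fintype.piFinset fun _ : Fin k => Finset.Icc 1 D).filter (fun d => Finset.univ.lcm d ≤ D), ((∏ i, ((ArithmeticFunction.moebius (d i) : ℝ) * Real.log (d i)) : ℝ) : ℂ) * ∑ ν ∈ (Finset.range (Finset.univ.lcm d)).filter (fun ν : ℕ => ∀ i, ((d i : ℕ) : ℤ) ∣ (f i).eval (ν : ℤ)), Complex.exp (2 * Real.pi * Complex.I * ((j : ℂ) * (ν : ℂ) / ((Finset.univ.lcm d : ℕ) : ℂ)))‖ ≤ C₁ * (D : ℝ) / Real.log D ^ A) →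
      Literature.NumberTheory.Sieve.BatemanHornAsymptotic f := by
  intro k f hf hDeep hNear hWeyl
  obtain ⟨C, hC, hBH, hS⟩ := h₁ k f hf
  obtain ⟨A, η, hA, hη, hNear'⟩ := hNear
  -- bridge the route's texts to this file's texts (definitional)
  have hNear'' : (fun x : ℕ => ∑ n ∈ Finset.Icc 1 (x ^ 2), Real.exp (-((n : ℝ) / x)) * ∑ d ∈ Fintype.piFinset (fun i => (((f i).eval (n : ℤ)).toNat).divisors), if (x : ℝ) * Real.log x ^ A < ((Finset.univ.lcm d : ℕ) : ℝ) ∧ ((Finset.univ.lcm d : ℕ) : ℝ) ≤ (x : ℝ) ^ (1 + η) then ∏ i, ((ArithmeticFunction.moebius (d i) : ℝ) * Real.log (d i)) else 0) =o[Filter.atTop] fun x : ℕ => (x : ℝ) := hNear'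
  have hDeep'' : (fun x : ℕ => ∑ n ∈ Finset.Icc 1 (x ^ 2), Real.exp (-((n : ℝ) / x)) * ∑ d ∈ Fintype.piFinset (fun i => (((f i).eval (n : ℤ)).toNat).divisors), if (x : ℝ) ^ (1 + η) < ((Finset.univ.lcm d : ℕ) : ℝ) then ∏ i, ((ArithmeticFunction.moebius (d i) : ℝ) * Real.log (d i)) else 0) =o[Filter.atTop] fun x : ℕ => (x : ℝ) := hDeep η hη
  have hLow : (fun x : ℕ => (∑ n ∈ Finset.Icc 1 (x ^ 2), Real.exp (-((n : ℝ) / x)) * ∑ d ∈ Fintype.piFinset (fun i => (((f i).eval (n : ℤ)).toNat).divisors), if ((Finset.univ.lcm d : ℕ) : ℝ) ≤ (x : ℝ) * Real.log x ^ A then ∏ i, ((ArithmeticFunction.moebius (d i) : ℝ) * Real.log (d i)) else 0) - ((-1 : ℝ) ^ k * C) * (x : ℝ)) =o[Filter.atTop] fun x : ℕ => (x : ℝ) :=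
    h₂ k f hf ((-1 : ℝ) ^ k * C) hS hWeyl A hA
  -- (−1)^k · (−1)^k = 1
  have hsq : (-1 : ℝ) ^ k * (-1 : ℝ) ^ k = 1 := by
    rw [← mul_pow]; norm_num
  -- eventually x (log x)^A ≤ x^(1+η)
  have hxy : ∀ᶠ x : ℕ in Filter.atTop, (x : ℝ) * Real.log x ^ A ≤ (x : ℝ) ^ (1 + η) := by
    have hlo := (tendsto_natCast_atTop_atTop (R := ℝ)).eventually
      ((isLittleO_log_rpow_rpow_atTop A hη).eventuallyLE)
    filter_upwards [hlo, Filter.eventually_ge_atTop 1] with x hx hx1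
    have hx0 : (0 : ℝ) < x := Nat.cast_pos.mpr (by omega)
    have hlog : 0 ≤ Real.log x := Real.log_nonneg (by exact_mod_cast hx1)
    have hx' : Real.log x ^ A ≤ (x : ℝ) ^ η := by
      have h := hx
      simp only [Real.norm_eq_abs] at h
      rwa [abs_of_nonneg (Real.rpow_nonneg hlog _), abs_of_nonneg (Real.rpow_nonneg hx0.le _)] at h
    calc (x : ℝ) * Real.log x ^ A ≤ (x : ℝ) * (x : ℝ) ^ η := mul_le_mul_of_nonneg_left hx' hx0.le
      _ = (x : ℝ) ^ (1 + η) := by rw [Real.rpow_add hx0, Real.rpow_one]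
  -- the smoothed Λ-count minus C·x is o(x)
  have hmain : (fun x : ℕ => (∑ n ∈ Finset.Icc 1 (x ^ 2), Real.exp (-((n : ℝ) / x)) * ∏ i, ArithmeticFunction.vonMangoldt (((f i).eval (n : ℤ)).toNat)) - C * (x : ℝ)) =o[Filter.atTop] fun x : ℕ => (x : ℝ) := by
    refine (((hLow.add hNear'').add hDeep'').const_mul_left ((-1 : ℝ) ^ k)).congr' ?_
      Filter.EventuallyEq.rfl
    filter_upwards [hxy] with x hx
    have ht := total_split f A η x hx
    linear_combination (-1 : ℝ) * ht + (-(C * (x : ℝ))) * hsq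
  -- hence the smoothed Λ-mean tends to C
  have hsmooth : Filter.Tendsto (fun x : ℕ => (∑ n ∈ Finset.Icc 1 (x ^ 2), Real.exp (-((n : ℝ) / x)) * ∏ i, ArithmeticFunction.vonMangoldt (((f i).eval (n : ℤ)).toNat)) / (x : ℝ)) Filter.atTop (nhds C) := by
    have h2 := (hmain.tendsto_div_nhds_zero).add_const C
    rw [zero_add] at h2
    refine h2.congr' ?_
    filter_upwards [Filter.eventually_gt_atTop 0] with x hx
    have hx' : (x : ℝ) ≠ 0 := by exact_mod_cast hx.ne'
    rw [sub_div, mul_div_assoc, div_self hx', mul_one, sub_add_cancel]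
  -- un-smooth (stub 3) and count (tree theorem, stmt-Parity-0874)
  have hsharp : Asymptotics.IsEquivalent Filter.atTop (fun x : ℕ => ∑ n ∈ Finset.Icc 1 x, ∏ i, ArithmeticFunction.vonMangoldt (((f i).eval (n : ℤ)).toNat)) (fun x : ℕ => C * (x : ℝ)) := h₃ k f hf C hC hsmooth
  exact Summit.Parity.BatemanHorn.LambdaToCount.lambdaToCount_proof k f hf C hC hBH hsharp

/-- **The line concludes the crux BY NAME** (the `#h21_check_skeleton` theorem): the three registered
stubs, fed to `frameToBH_of_parts`, give `Summit.Parity.BatemanHorn.Theses.LambertRoots.FrameToBH`.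
No `sorry` of its own; its axiom closure contains `sorryAx` exactly through the three `stub_*`. -/
theorem FrameToBH_of : FrameToBH :=
  frameToBH_of_parts stub_singularSeriesLcm stub_lowLcmRange stub_tauberStep

end Summit.Parity.BatemanHorn.Cruxes.FrameToBH.Birth
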